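import Summits.BirchSwinnertonDyer.BirchSwinnertonDyer.Theses.TangentCone
import Summits.BirchSwinnertonDyer.BirchSwinnertonDyer.Theorems.TangentConeEdgeCapUniformReference
import Summits.BirchSwinnertonDyer.BirchSwinnertonDyer.Theorems.TangentConeEdgeCapFibreStrassmann
import Summits.BirchSwinnertonDyer.BirchSwinnertonDyer.Theorems.TangentConeEdgeCapStubContentDivision
import Summits.BirchSwinnertonDyer.BirchSwinnertonDyer.Theorems.TangentConeEdgeCapStubNormOneAddPowSubOne
import Summits.BirchSwinnertonDyer.BirchSwinnertonDyer.Theorems.TangentConeEdgeCapMembersExistOfHida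
import Summits.BirchSwinnertonDyer.BirchSwinnertonDyer.Theorems.TangentConeEdgeCapInterpolantOfGS
import HarnessLib

/-!
# BirchSwinnertonDyer / TangentCone — crux `EdgeCap` (stmt-BirchSwinnertonDyer-17609): `EdgeCap` from the arc
# divisibility A2 and three named facts (line `ratio_measure_strassmann`, skeleton v7 — the composition, importable)

`EdgeCap_of_stubs : M → A1 → A2 → EdgeCap` is the sorry-free composition of the registered skeleton
(`Cruxes/EdgeCap/Lines/ratio_measure_strassmann.lean`) with the stub STATEMENTS as hypotheses (verbatim) over the landed
analytic layers S `fibreStrassmann` p147405, U `uniformReference` p147403, D `stub_contentDivision` p147852,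
T `stub_normOneAddPowSubOne` p147846; `EdgeCap_of_facts : hida_exists_congruent_ordinary_newform →
greenbergStevens_kitagawa_twoVariable_interpolation → exists_isNewformOf → (A2 verbatim) → EdgeCap` assembles it with the
landed reductions M ⟸ Hida (`stub_membersExist_of_hida` p147924) and A1 ⟸ GS + modularity (`interpolant_of_facts` p153728).
Hence the crux costs, beyond three NAMED FACTS of the tree (Hida 1986 members; Greenberg–Stevens 1993 / Kitagawa 1994
interpolation; the Modularity Theorem), EXACTLY statement A2 `stub_arcDivisibility` (arc order `≥ corank_{ℤ_p} Sel_{p^∞}(E/ℚ)`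
of the two-variable `p`-adic `L`-function; the 2001 two-variable tangent-cone Thm C, unprinted as an assembly), which the lead
recommends promoting to a route item. Proof of the composition (v5 of the line): coprime reduction of the slope; A1 gives
`F`; A2 (fed with M) the arc bound; D gives `F = P·Q` with `Q` free of vertical zeros; S+U give a reference `j ≤ 2J+1` per
weight with `1 ≤ ‖Q(x_k,y_j)‖p^C`; the ratio identity divided by `|P(x_k)| ≠ 0`; the dichotomy `‖t‖ ≥ p^{-E}` / `< p^{-E}`
(then `|P(x_k)| ≥ p^{-E|zs|}` by T); `v_p(k−2) = v_p(b') + v_p(t)`. `EdgeCap_of_facts` is a registered colon-form sub-goal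
stub; the file SUPPORTS stmt-BirchSwinnertonDyer-17609 and closes nothing (A2 is a hypothesis, the facts are undischarged).
-/

-- D-0017: single-problem summit, so `Summit.BirchSwinnertonDyer.BirchSwinnertonDyer.…` repeats a
-- namespace BY DESIGN.
set_option linter.dupNamespace false

noncomputable section

namespace Summit.BirchSwinnertonDyer.BirchSwinnertonDyer.Theorems

namespace TangentConeEdgeCap

section ListNorms

variable {p : ℕ} [Fact p.Prime]

/-- `c ^ |zs| ≤ ‖∏_{z ∈ zs} (x − z)‖` when every factor has norm `≥ c ≥ 0`. -/
theorem pow_length_le_norm_prod_map_sub {x : ℚ_[p]} {c : ℝ} (hc : 0 ≤ c) (zs : List ℚ_[p])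
    (h : ∀ z ∈ zs, c ≤ ‖x - z‖) : c ^ zs.length ≤ ‖(zs.map fun z => x - z).prod‖ := by
  induction zs with
  | nil => simp
  | cons a l ih =>
    simp only [List.length_cons, List.map_cons, List.prod_cons, pow_succ, norm_mul]
    have ha : c ≤ ‖x - a‖ := h a (by simp)
    have hl : c ^ l.length ≤ ‖(l.map fun z => x - z).prod‖ := ih fun r hr => h r (by simp [hr])
    calc c ^ l.length * c = c * c ^ l.length := mul_comm _ _
      _ ≤ ‖x - a‖ * ‖(l.map fun z => x - z).prod‖ := mul_le_mul ha hl (pow_nonneg hc _) (norm_nonneg _)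

/-- For a finite list of non-zero `p`-adic numbers there is `E` with `p^{-E} ≤ ‖z‖` for all of them. -/
theorem exists_pow_neg_le_norm_of_list (l : List ℚ_[p]) (h : ∀ z ∈ l, z ≠ 0) :
    ∃ E : ℕ, ∀ z ∈ l, ((p : ℝ) ^ E)⁻¹ ≤ ‖z‖ := by
  have hp1 : (1 : ℝ) < p := by exact_mod_cast (Fact.out : p.Prime).one_lt
  induction l with
  | nil => exact ⟨0, by simp⟩
  | cons a l ih =>
    obtain ⟨E, hE⟩ := ih fun z hz => h z (by simp [hz])
    have ha' : 0 < ‖a‖ := norm_pos_iff.mpr (h a (by simp))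
    obtain ⟨n, hn⟩ := pow_unbounded_of_one_lt ‖a‖⁻¹ hp1
    refine ⟨max E n, fun z hz => ?_⟩
    rcases List.mem_cons.mp hz with rfl | hz
    · exact le_trans (by gcongr; exacts [hp1.le, le_max_right _ _]) ((inv_le_comm₀ (by positivity) ha').mpr hn.le)
    · exact le_trans (by gcongr; exacts [hp1.le, le_max_left _ _]) (hE z hz)

end ListNorms

end TangentConeEdgeCap

open Summit.BirchSwinnertonDyer.BirchSwinnertonDyer.Theses.TangentCone
open Literature.NumberTheory.EllipticCurves TangentConeEdgeCap
  Summit.BirchSwinnertonDyer.BirchSwinnertonDyer.Theorems.EdgeCap.Negative in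
/-- **`EdgeCap` from the statements M, A1, A2 of line `ratio_measure_strassmann`** (the skeleton's
composition, verbatim; see the module docstring for the proof). -/
theorem EdgeCap_of_stubs
    (hM :
      ∀ (W : WeierstrassCurve ℚ) [W.IsElliptic] [W.IsGloballyMinimal] (_ : NeZero (W.conductorNorm ℤ)) (p : ℕ) [Fact
      p.Prime], 5 ≤ p → W.HasGoodReductionAtPrime p → ¬ (p : ℤ) ∣ W.frobeniusTrace p → ∀ (b : ℕ), 0 < b → (∀ t : ℕ,
      0 < t → ∃ (g : CuspForm (CongruenceSubgroup.Gamma0 (W.conductorNorm ℤ)) ((2 + 2 * b * (p - 1) * t : ℕ) : ℤ))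
      (ι : Literature.NumberTheory.EllipticCurves.ModularForms.coeffField g →+* PadicAlgCl p),
      Literature.NumberTheory.EllipticCurves.ModularForms.IsNewform0 g ∧ ‖ι ⟨(UpperHalfPlane.qExpansion 1 ⇑g).coeff
      p, Literature.NumberTheory.EllipticCurves.ModularForms.coeff_mem_coeffField g p⟩‖ = 1 ∧ (∀ ℓ : ℕ, ℓ.Prime → ¬
      ℓ ∣ W.conductorNorm ℤ * p → ‖ι ⟨(UpperHalfPlane.qExpansion 1 ⇑g).coeff ℓ,
      Literature.NumberTheory.EllipticCurves.ModularForms.coeff_mem_coeffField g ℓ⟩ - ((W.frobeniusTrace ℓ : ℤ) :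
      PadicAlgCl p)‖ < 1)))
    (hA1 :
      ∀ (W : WeierstrassCurve ℚ) [W.IsElliptic] [W.IsGloballyMinimal] (_ : NeZero (W.conductorNorm ℤ)) (p : ℕ) [Fact
      p.Prime], 5 ≤ p → W.HasGoodReductionAtPrime p → ¬ (p : ℤ) ∣ W.frobeniusTrace p → ¬ (p : ℤ) ∣ (W.frobeniusTrace
      p) ^ 2 - 1 → W.HasSurjectiveModNGaloisRep p → (∀ (M : ℕ) (_ : NeZero M) (g : CuspForm
      (CongruenceSubgroup.Gamma0 M) 2) (ι : Literature.NumberTheory.EllipticCurves.ModularForms.coeffField g →+*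
      PadicAlgCl p), M ∣ W.conductorNorm ℤ * p → Literature.NumberTheory.EllipticCurves.ModularForms.IsNewform0 g →
      ‖ι ⟨(UpperHalfPlane.qExpansion 1 ⇑g).coeff p,
      Literature.NumberTheory.EllipticCurves.ModularForms.coeff_mem_coeffField g p⟩‖ = 1 → (∀ ℓ : ℕ, ℓ.Prime → ¬ ℓ ∣
      W.conductorNorm ℤ * p → ‖ι ⟨(UpperHalfPlane.qExpansion 1 ⇑g).coeff ℓ,
      Literature.NumberTheory.EllipticCurves.ModularForms.coeff_mem_coeffField g ℓ⟩ - ((W.frobeniusTrace ℓ : ℤ) :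
      PadicAlgCl p)‖ < 1) → M = W.conductorNorm ℤ ∧ ∀ n : ℕ, (UpperHalfPlane.qExpansion 1 ⇑g).coeff n =
      ((W.LFunction n : ℤ) : ℂ)) → ∀ (a b : ℕ), 0 < b → 2 * a < b → a.Coprime b → ∃ F : MvPowerSeries (Fin 2) ℚ_[p],
      Literature.NumberTheory.EllipticCurves.IsPadicInt F ∧ (∃ i : ℕ, MvPowerSeries.coeff (Finsupp.single 1 i) F ≠
      0) ∧ (∀ (k : ℤ) (g : CuspForm (CongruenceSubgroup.Gamma0 (W.conductorNorm ℤ)) k) (ι :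
      Literature.NumberTheory.EllipticCurves.ModularForms.coeffField g →+* PadicAlgCl p) (s : ℕ), (2 * b * (p - 1) :
      ℤ) ∣ (k - 2) → (b : ℤ) * ((s : ℤ) - 1) = a * (k - 2) →
      Literature.NumberTheory.EllipticCurves.ModularForms.IsNewform0 g → ‖ι ⟨(UpperHalfPlane.qExpansion 1 ⇑g).coeff
      p, Literature.NumberTheory.EllipticCurves.ModularForms.coeff_mem_coeffField g p⟩‖ = 1 → (∀ ℓ : ℕ, ℓ.Prime → ¬
      ℓ ∣ W.conductorNorm ℤ * p → ‖ι ⟨(UpperHalfPlane.qExpansion 1 ⇑g).coeff ℓ,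
      Literature.NumberTheory.EllipticCurves.ModularForms.coeff_mem_coeffField g ℓ⟩ - ((W.frobeniusTrace ℓ : ℤ) :
      PadicAlgCl p)‖ < 1) → ∀ j : ℕ, Odd j → 3 ≤ j → (p - 1) ∣ (j - 1) → 2 * (j : ℤ) + 2 ≤ k →
      Literature.NumberTheory.EllipticCurves.padicEval₂ F ((1 + (p : ℚ_[p])) ^ (k - 2) - 1) ((1 + (p : ℚ_[p])) ^ (j
      - 1) - 1) ≠ 0 ∧ ∀ hR : (∫ t in Set.Ioi (0 : ℝ), ((t : ℂ) ^ (s - 1)) * g (UpperHalfPlane.ofComplex ((t : ℂ) *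
      Complex.I))) / (∫ t in Set.Ioi (0 : ℝ), ((t : ℂ) ^ (j - 1)) * g (UpperHalfPlane.ofComplex ((t : ℂ) *
      Complex.I))) ∈ Literature.NumberTheory.EllipticCurves.ModularForms.coeffField g, ‖ι ⟨_, hR⟩‖ *
      ‖Literature.NumberTheory.EllipticCurves.padicEval₂ F ((1 + (p : ℚ_[p])) ^ (k - 2) - 1) ((1 + (p : ℚ_[p])) ^ (j
      - 1) - 1)‖ = ‖Literature.NumberTheory.EllipticCurves.padicEval₂ F ((1 + (p : ℚ_[p])) ^ (k - 2) - 1) ((1 + (p :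
      ℚ_[p])) ^ (s - 1) - 1)‖))
    (hA2 :
      ∀ (W : WeierstrassCurve ℚ) [W.IsElliptic] [W.IsGloballyMinimal] (_ : NeZero (W.conductorNorm ℤ)) (p : ℕ) [Fact
      p.Prime], 5 ≤ p → W.HasGoodReductionAtPrime p → ¬ (p : ℤ) ∣ W.frobeniusTrace p → ¬ (p : ℤ) ∣ (W.frobeniusTrace
      p) ^ 2 - 1 → W.HasSurjectiveModNGaloisRep p → (∀ (M : ℕ) (_ : NeZero M) (g : CuspForm
      (CongruenceSubgroup.Gamma0 M) 2) (ι : Literature.NumberTheory.EllipticCurves.ModularForms.coeffField g →+*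
      PadicAlgCl p), M ∣ W.conductorNorm ℤ * p → Literature.NumberTheory.EllipticCurves.ModularForms.IsNewform0 g →
      ‖ι ⟨(UpperHalfPlane.qExpansion 1 ⇑g).coeff p,
      Literature.NumberTheory.EllipticCurves.ModularForms.coeff_mem_coeffField g p⟩‖ = 1 → (∀ ℓ : ℕ, ℓ.Prime → ¬ ℓ ∣
      W.conductorNorm ℤ * p → ‖ι ⟨(UpperHalfPlane.qExpansion 1 ⇑g).coeff ℓ,
      Literature.NumberTheory.EllipticCurves.ModularForms.coeff_mem_coeffField g ℓ⟩ - ((W.frobeniusTrace ℓ : ℤ) :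
      PadicAlgCl p)‖ < 1) → M = W.conductorNorm ℤ ∧ ∀ n : ℕ, (UpperHalfPlane.qExpansion 1 ⇑g).coeff n =
      ((W.LFunction n : ℤ) : ℂ)) → ∀ (a b : ℕ), 0 < b → 2 * a < b → a.Coprime b → ∀ F : MvPowerSeries (Fin 2) ℚ_[p],
      Literature.NumberTheory.EllipticCurves.IsPadicInt F → (∃ i : ℕ, MvPowerSeries.coeff (Finsupp.single 1 i) F ≠
      0) → (∀ (k : ℤ) (g : CuspForm (CongruenceSubgroup.Gamma0 (W.conductorNorm ℤ)) k) (ι :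
      Literature.NumberTheory.EllipticCurves.ModularForms.coeffField g →+* PadicAlgCl p) (s : ℕ), (2 * b * (p - 1) :
      ℤ) ∣ (k - 2) → (b : ℤ) * ((s : ℤ) - 1) = a * (k - 2) →
      Literature.NumberTheory.EllipticCurves.ModularForms.IsNewform0 g → ‖ι ⟨(UpperHalfPlane.qExpansion 1 ⇑g).coeff
      p, Literature.NumberTheory.EllipticCurves.ModularForms.coeff_mem_coeffField g p⟩‖ = 1 → (∀ ℓ : ℕ, ℓ.Prime → ¬
      ℓ ∣ W.conductorNorm ℤ * p → ‖ι ⟨(UpperHalfPlane.qExpansion 1 ⇑g).coeff ℓ,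
      Literature.NumberTheory.EllipticCurves.ModularForms.coeff_mem_coeffField g ℓ⟩ - ((W.frobeniusTrace ℓ : ℤ) :
      PadicAlgCl p)‖ < 1) → ∀ j : ℕ, Odd j → 3 ≤ j → (p - 1) ∣ (j - 1) → 2 * (j : ℤ) + 2 ≤ k →
      Literature.NumberTheory.EllipticCurves.padicEval₂ F ((1 + (p : ℚ_[p])) ^ (k - 2) - 1) ((1 + (p : ℚ_[p])) ^ (j
      - 1) - 1) ≠ 0 ∧ ∀ hR : (∫ t in Set.Ioi (0 : ℝ), ((t : ℂ) ^ (s - 1)) * g (UpperHalfPlane.ofComplex ((t : ℂ) *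
      Complex.I))) / (∫ t in Set.Ioi (0 : ℝ), ((t : ℂ) ^ (j - 1)) * g (UpperHalfPlane.ofComplex ((t : ℂ) *
      Complex.I))) ∈ Literature.NumberTheory.EllipticCurves.ModularForms.coeffField g, ‖ι ⟨_, hR⟩‖ *
      ‖Literature.NumberTheory.EllipticCurves.padicEval₂ F ((1 + (p : ℚ_[p])) ^ (k - 2) - 1) ((1 + (p : ℚ_[p])) ^ (j
      - 1) - 1)‖ = ‖Literature.NumberTheory.EllipticCurves.padicEval₂ F ((1 + (p : ℚ_[p])) ^ (k - 2) - 1) ((1 + (p :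
      ℚ_[p])) ^ (s - 1) - 1)‖) → (∀ t : ℕ, 0 < t → ∃ (g : CuspForm (CongruenceSubgroup.Gamma0 (W.conductorNorm ℤ))
      ((2 + 2 * b * (p - 1) * t : ℕ) : ℤ)) (ι : Literature.NumberTheory.EllipticCurves.ModularForms.coeffField g →+*
      PadicAlgCl p), Literature.NumberTheory.EllipticCurves.ModularForms.IsNewform0 g ∧ ‖ι
      ⟨(UpperHalfPlane.qExpansion 1 ⇑g).coeff p,
      Literature.NumberTheory.EllipticCurves.ModularForms.coeff_mem_coeffField g p⟩‖ = 1 ∧ (∀ ℓ : ℕ, ℓ.Prime → ¬ ℓ ∣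
      W.conductorNorm ℤ * p → ‖ι ⟨(UpperHalfPlane.qExpansion 1 ⇑g).coeff ℓ,
      Literature.NumberTheory.EllipticCurves.ModularForms.coeff_mem_coeffField g ℓ⟩ - ((W.frobeniusTrace ℓ : ℤ) :
      PadicAlgCl p)‖ < 1)) → ∃ C₀ : ℕ, ∀ t : ℕ, 0 < t → ‖Literature.NumberTheory.EllipticCurves.padicEval₂ F ((1 +
      (p : ℚ_[p])) ^ (2 * b * (p - 1) * t) - 1) ((1 + (p : ℚ_[p])) ^ (2 * a * (p - 1) * t) - 1)‖ ≤ (p : ℝ) ^ C₀ *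
      ‖(t : ℚ_[p])‖ ^ W.selmerCorank p) :
    EdgeCap := by
  have hD := @Summit.BirchSwinnertonDyer.BirchSwinnertonDyer.Theorems.stub_contentDivision
  have hT := @Summit.BirchSwinnertonDyer.BirchSwinnertonDyer.Theorems.stub_normOneAddPowSubOne
  have hS := @fibreStrassmann
  have hU := @uniformReference
  intro W _ _ hN p _ h5 hgood hord hna hsurj hBr a b hb hab
  have hp1 : (1 : ℝ) < p := by exact_mod_cast (Fact.out : p.Prime).one_lt
  have hp1' : (1 : ℝ) ≤ (p : ℝ) := hp1.le
  have hp0 : (0 : ℝ) ≤ (p : ℝ) := le_trans zero_le_one hp1'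
  -- reduction to a coprime slope pair
  obtain ⟨d, a', b', hd0, rfl, rfl, hcop⟩ : ∃ d a' b' : ℕ, 0 < d ∧ a = a' * d ∧ b = b' * d ∧ a'.Coprime b' :=
    ⟨Nat.gcd a b, a / Nat.gcd a b, b / Nat.gcd a b, Nat.gcd_pos_of_pos_right a hb,
      (Nat.div_mul_cancel (Nat.gcd_dvd_left a b)).symm, (Nat.div_mul_cancel (Nat.gcd_dvd_right a b)).symm,
      Nat.coprime_div_gcd_div_gcd (Nat.gcd_pos_of_pos_right a hb)⟩
  have hb'0 : 0 < b' := Nat.pos_of_ne_zero (by rintro rfl; simp at hb)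
  have hab' : 2 * a' < b' := by
    by_contra hle
    push Not at hle
    nlinarith [Nat.mul_le_mul_right d hle]
  -- A1: the interpolant; M: members; A2: the arc bound; D: content division; S+U: uniform reference for `Q`
  obtain ⟨F, hFi, hwt2, hinterp⟩ := hA1 W hN p h5 hgood hord hna hsurj hBr a' b' hb'0 hab' hcop
  have hmem := hM W hN p h5 hgood hord b' hb'0
  obtain ⟨C₀, harc⟩ := hA2 W hN p h5 hgood hord hna hsurj hBr a' b' hb'0 hab' hcop F hFi hwt2 hinterp hmem
  obtain ⟨Q, zs, hQi, hzs, hfac, hQvert⟩ := hD p F hFi hwt2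
  obtain ⟨J, C, href⟩ := hU p Q hQi (hS p Q hQi hQvert)
  obtain ⟨E, hE⟩ := exists_pow_neg_le_norm_of_list zs fun z hz => (hzs z hz).1
  -- constants
  set sp : ℕ := W.selmerCorank p with hsp
  refine ⟨2 * J + 1, C + (C₀ + E * zs.length + E * sp) + sp * (1 + padicValNat p b'), ?_⟩
  intro k g ι s hdiv hkJ hs hnew hordg hcong
  -- the weight parameter `t`: `k − 2 = 2 b' (p−1) t`, `t ≥ 1`
  have hk2 : 0 < k - 2 := by push_cast at hkJ; omega
  have hprog : ((2 * b' * (p - 1) : ℕ) : ℤ) ∣ k - 2 := by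
    refine dvd_trans ⟨(d : ℤ), ?_⟩ hdiv
    push_cast [Nat.cast_sub (show 1 ≤ p by omega)]
    ring
  obtain ⟨q, hq⟩ := hprog
  have hn0 : 0 < 2 * b' * (p - 1) := Nat.mul_pos (Nat.mul_pos two_pos hb'0) (by omega)
  have hq0 : 0 < q := by
    rcases lt_trichotomy q 0 with h | h | h
    · have : ((2 * b' * (p - 1) : ℕ) : ℤ) * q < 0 := mul_neg_of_pos_of_neg (by exact_mod_cast hn0) h
      omega
    · subst h; simp at hq; omega
    · exact h
  obtain ⟨t, rfl⟩ := Int.eq_ofNat_of_zero_le hq0.le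
  have ht0 : t ≠ 0 := by rintro rfl; simp at hq0
  have ht0' : 0 < t := Nat.pos_of_ne_zero ht0
  have hkt : k - 2 = ((2 * b' * (p - 1) * t : ℕ) : ℤ) := by rw [hq]; push_cast; ring
  -- the point `x_k` and its size
  set x : ℚ_[p] := (1 + (p : ℚ_[p])) ^ (k - 2) - 1 with hxdef
  have hxnat : x = (1 + (p : ℚ_[p])) ^ (2 * b' * (p - 1) * t) - 1 := by rw [hxdef, hkt, zpow_natCast]
  have hx : ‖x‖ < 1 := by rw [hxnat]; exact norm_one_add_pow_sub_one_lt p _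
  have hxt : ‖x‖ ≤ ‖(t : ℚ_[p])‖ := by
    rw [hxnat]
    refine (hT p (by omega) (2 * b' * (p - 1) * t)).trans ?_
    have h1 : ‖(p : ℚ_[p])‖ ≤ 1 := by simpa using Padic.norm_int_le_one (p := p) (p : ℤ)
    have h2 : ‖((2 * b' * (p - 1) * t : ℕ) : ℚ_[p])‖ ≤ ‖(t : ℚ_[p])‖ := by
      have : ((2 * b' * (p - 1) * t : ℕ) : ℚ_[p]) = ((2 * b' * (p - 1) : ℕ) : ℚ_[p]) * (t : ℚ_[p]) := by push_cast; ring
      rw [this, norm_mul]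
      refine mul_le_of_le_one_left (norm_nonneg _) ?_
      simpa using Padic.norm_int_le_one (p := p) ((2 * b' * (p - 1) : ℕ) : ℤ)
    calc ‖(p : ℚ_[p])‖ * ‖((2 * b' * (p - 1) * t : ℕ) : ℚ_[p])‖ ≤ 1 * ‖(t : ℚ_[p])‖ := by gcongr
      _ = ‖(t : ℚ_[p])‖ := one_mul _
  -- the reference index (for `Q`, from S+U)
  obtain ⟨j, hjodd, hj3, hjp, hjJ, hlow⟩ := href x hx
  refine ⟨j, hjodd, hj3, by omega, fun hR => ?_⟩
  have hjk : 2 * (j : ℤ) + 2 ≤ k := by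
    have : (j : ℤ) ≤ 2 * J + 1 := by exact_mod_cast hjJ
    push_cast at hkJ
    omega
  -- hypotheses of A1(interp) for the coprime pair
  have hdiv' : (2 * (b' : ℕ) * (p - 1) : ℤ) ∣ (k - 2) := dvd_trans ⟨(d : ℤ), by push_cast; ring⟩ hdiv
  have hs' : ((b' : ℕ) : ℤ) * ((s : ℤ) - 1) = (a' : ℕ) * (k - 2) := by
    have hd0' : (d : ℤ) ≠ 0 := by exact_mod_cast hd0.ne'
    have h1 : (d : ℤ) * ((b' : ℤ) * ((s : ℤ) - 1)) = (d : ℤ) * ((a' : ℤ) * (k - 2)) := by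
      have := hs
      push_cast at this
      linear_combination this
    exact mul_left_cancel₀ hd0' h1
  obtain ⟨hFne, hratio⟩ := hinterp k g ι s hdiv' hs' hnew hordg hcong j hjodd hj3 hjp hjk
  specialize hratio hR
  -- `s − 1 = 2 a' (p−1) t`
  have hs1 : s - 1 = 2 * a' * (p - 1) * t := by
    have hb'0' : ((b' : ℕ) : ℤ) ≠ 0 := by exact_mod_cast hb'0.ne'
    have h1 : ((b' : ℕ) : ℤ) * ((s : ℤ) - 1) = ((b' : ℕ) : ℤ) * (((2 * a' * (p - 1) * t : ℕ) : ℤ)) := by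
      rw [hs', hkt]; push_cast; ring
    have h2 := mul_left_cancel₀ hb'0' h1
    omega
  -- the points
  set yj : ℚ_[p] := (1 + (p : ℚ_[p])) ^ (j - 1) - 1 with hyjdef
  set ys : ℚ_[p] := (1 + (p : ℚ_[p])) ^ (s - 1) - 1 with hysdef
  have hyj : ‖yj‖ < 1 := norm_one_add_pow_sub_one_lt p _
  have hys : ‖ys‖ < 1 := norm_one_add_pow_sub_one_lt p _
  -- factorisation `F = P · Q` at the two points
  set P : ℚ_[p] := (zs.map fun z => x - z).prod with hPdef
  have hfacj : padicEval₂ F x yj = P * padicEval₂ Q x yj := hfac x yj hx hyj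
  have hfacs : padicEval₂ F x ys = P * padicEval₂ Q x ys := hfac x ys hx hys
  have hP0 : P ≠ 0 := fun hP0 => hFne (show padicEval₂ F x yj = 0 by rw [hfacj, hP0, zero_mul])
  have hPpos : 0 < ‖P‖ := norm_pos_iff.mpr hP0
  -- the ratio identity for `Q`
  have hratioQ : ‖ι ⟨_, hR⟩‖ * ‖padicEval₂ Q x yj‖ = ‖padicEval₂ Q x ys‖ := by
    have h := hratio
    change ‖ι ⟨_, hR⟩‖ * ‖padicEval₂ F x yj‖ = ‖padicEval₂ F x ys‖ at h
    rw [hfacj, hfacs, norm_mul, norm_mul] at h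
    have h' : ‖P‖ * (‖ι ⟨_, hR⟩‖ * ‖padicEval₂ Q x yj‖) = ‖P‖ * ‖padicEval₂ Q x ys‖ := by
      linear_combination h
    exact mul_left_cancel₀ hPpos.ne' h'
  -- the arc bound for `Q` at `t`: `‖Q(x, ys)‖ ≤ p^{C₁} ‖t‖^{sp}`, `C₁ = C₀ + E |zs| + E sp`
  have harcF : ‖padicEval₂ F x ys‖ ≤ (p : ℝ) ^ C₀ * ‖(t : ℚ_[p])‖ ^ sp := by rw [hxnat, hysdef, hs1]; exact harc t ht0'
  have hτ0 : 0 < ‖(t : ℚ_[p])‖ := norm_pos_iff.mpr (by exact_mod_cast ht0)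
  have hQs1 : ‖padicEval₂ Q x ys‖ ≤ 1 := norm_padicEval₂_le_one hQi hx hys
  have harcQ : ‖padicEval₂ Q x ys‖ ≤ (p : ℝ) ^ (C₀ + E * zs.length + E * sp) * ‖(t : ℚ_[p])‖ ^ sp := by
    by_cases hcase : ((p : ℝ) ^ E)⁻¹ ≤ ‖(t : ℚ_[p])‖
    · -- trivial case: `‖t‖` is not small
      have h1 : (1 : ℝ) ≤ (p : ℝ) ^ (E * sp) * ‖(t : ℚ_[p])‖ ^ sp := by
        rw [pow_mul, ← mul_pow]
        exact one_le_pow₀ ((inv_le_iff_one_le_mul₀' (by positivity)).mp hcase)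
      calc ‖padicEval₂ Q x ys‖ ≤ 1 := hQs1
        _ ≤ (p : ℝ) ^ (E * sp) * ‖(t : ℚ_[p])‖ ^ sp := h1
        _ ≤ (p : ℝ) ^ (C₀ + E * zs.length + E * sp) * ‖(t : ℚ_[p])‖ ^ sp :=
            mul_le_mul_of_nonneg_right (pow_le_pow_right₀ hp1' (by omega)) (by positivity)
    · -- `‖t‖ < p^{-E} ≤ ‖z‖` for every divided zero `z`: then `‖x − z‖ = ‖z‖`
      push Not at hcase
      have hxz : ∀ z ∈ zs, ‖x - z‖ = ‖z‖ := by
        intro z hz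
        have hlt : ‖x‖ < ‖z‖ := lt_of_le_of_lt hxt (hcase.trans_le (hE z hz))
        have h := Padic.norm_eq_of_norm_sub_lt_right (z1 := x - z) (z2 := -z)
          (by rw [sub_neg_eq_add, sub_add_cancel, norm_neg]; exact hlt)
        rwa [norm_neg] at h
      have hPge : ((p : ℝ) ^ (E * zs.length))⁻¹ ≤ ‖P‖ := by
        rw [hPdef, pow_mul, ← inv_pow]
        exact pow_length_le_norm_prod_map_sub (by positivity) zs fun z hz => by
          rw [hxz z hz]; exact hE z hz
      -- `‖Q(x, ys)‖ = ‖F(x, ys)‖ / ‖P‖`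
      have hQeq : ‖padicEval₂ Q x ys‖ = ‖padicEval₂ F x ys‖ / ‖P‖ := by
        rw [hfacs, norm_mul, mul_div_cancel_left₀ _ hPpos.ne']
      rw [hQeq, div_le_iff₀ hPpos]
      calc ‖padicEval₂ F x ys‖ ≤ (p : ℝ) ^ C₀ * ‖(t : ℚ_[p])‖ ^ sp := harcF
        _ = (p : ℝ) ^ C₀ * ‖(t : ℚ_[p])‖ ^ sp * (((p : ℝ) ^ (E * zs.length)) * ((p : ℝ) ^ (E * zs.length))⁻¹) := by
            rw [mul_inv_cancel₀ (by positivity), mul_one]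
        _ = (p : ℝ) ^ (C₀ + E * zs.length) * ‖(t : ℚ_[p])‖ ^ sp * ((p : ℝ) ^ (E * zs.length))⁻¹ := by
            rw [pow_add]; ring
        _ ≤ (p : ℝ) ^ (C₀ + E * zs.length + E * sp) * ‖(t : ℚ_[p])‖ ^ sp * ‖P‖ := by
            refine mul_le_mul ?_ hPge (by positivity) (by positivity)
            exact mul_le_mul_of_nonneg_right (pow_le_pow_right₀ hp1' (by omega)) (by positivity)
  -- valuation bookkeeping: `v_p(k − 2) = v_p(b') + v_p(t)` (`p ∤ 2(p−1)` as `p ≥ 5`)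
  have hval : padicValInt p (k - 2) = padicValNat p b' + padicValNat p t := by
    have hp2 : ¬ p ∣ 2 := fun h => by have := Nat.le_of_dvd two_pos h; omega
    have hpp : ¬ p ∣ (p - 1) := fun h => by
      have := Nat.le_of_dvd (by omega) h; omega
    have h2 : padicValNat p 2 = 0 := padicValNat.eq_zero_of_not_dvd hp2
    have hp1v : padicValNat p (p - 1) = 0 := padicValNat.eq_zero_of_not_dvd hpp
    rw [hkt, padicValInt.of_nat, padicValNat.mul (by positivity) ht0, padicValNat.mul (by positivity) (by omega),
      padicValNat.mul (by norm_num) hb'0.ne', h2, hp1v]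
    ring
  have hone : ‖(t : ℚ_[p])‖ * (p : ℝ) ^ padicValNat p t = 1 := norm_natCast_mul_pow_padicValNat p ht0
  -- real-number assembly
  set y : ℝ := ‖ι ⟨_, hR⟩‖ with hy
  set A : ℝ := ‖padicEval₂ Q x yj‖ with hAdef
  set B : ℝ := ‖padicEval₂ Q x ys‖ with hBdef
  set τ : ℝ := ‖(t : ℚ_[p])‖ with hτ
  set C₁ : ℕ := C₀ + E * zs.length + E * sp with hC₁
  have hy0 : 0 ≤ y := norm_nonneg _
  have hτ0' : 0 ≤ τ := norm_nonneg _
  have hA0 : 0 ≤ A := norm_nonneg _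
  have key : y * (p : ℝ) ^ (sp * padicValNat p t) ≤ (p : ℝ) ^ (C + C₁) := by
    have hτpow : τ ^ sp * (p : ℝ) ^ (sp * padicValNat p t) = 1 := by
      rw [pow_mul', ← mul_pow, hone, one_pow]
    calc y * (p : ℝ) ^ (sp * padicValNat p t)
        = y * (p : ℝ) ^ (sp * padicValNat p t) * 1 := by ring
      _ ≤ y * (p : ℝ) ^ (sp * padicValNat p t) * (A * (p : ℝ) ^ C) :=
          mul_le_mul_of_nonneg_left hlow (mul_nonneg hy0 (pow_nonneg hp0 _))
      _ = (y * A) * (p : ℝ) ^ (sp * padicValNat p t) * (p : ℝ) ^ C := by ring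
      _ = B * (p : ℝ) ^ (sp * padicValNat p t) * (p : ℝ) ^ C := by rw [hratioQ]
      _ ≤ ((p : ℝ) ^ C₁ * τ ^ sp) * (p : ℝ) ^ (sp * padicValNat p t) * (p : ℝ) ^ C := by
          gcongr
      _ = (p : ℝ) ^ C₁ * (p : ℝ) ^ C * (τ ^ sp * (p : ℝ) ^ (sp * padicValNat p t)) := by ring
      _ = (p : ℝ) ^ (C + C₁) := by rw [hτpow, mul_one, ← pow_add, add_comm]
  calc y * (p : ℝ) ^ (sp * (1 + padicValInt p (k - 2)))
      = y * (p : ℝ) ^ (sp * padicValNat p t) * (p : ℝ) ^ (sp * (1 + padicValNat p b')) := by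
        rw [hval, mul_assoc, ← pow_add]; ring_nf
    _ ≤ (p : ℝ) ^ (C + C₁) * (p : ℝ) ^ (sp * (1 + padicValNat p b')) :=
        mul_le_mul_of_nonneg_right key (pow_nonneg hp0 _)
    _ = (p : ℝ) ^ (C + C₁ + sp * (1 + padicValNat p b')) := (pow_add _ _ _).symm

open Summit.BirchSwinnertonDyer.BirchSwinnertonDyer.Theses.TangentCone in
/-- **`EdgeCap` from the arc divisibility A2 and three named facts** (registered colon form, sub-goal stub
`EdgeCap_of_facts` of stmt-BirchSwinnertonDyer-17609): Hida's members (`hida_exists_congruent_ordinary_newform`),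
the Greenberg–Stevens/Kitagawa two-variable interpolation (`greenbergStevens_kitagawa_twoVariable_interpolation`)
and modularity (`exists_isNewformOf`) reduce the crux `TangentCone.EdgeCap` to the statement of stub A2
`stub_arcDivisibility` (arc order `≥` Selmer corank, for every interpolant). [cite: GreenbergStevens1993, Thm 5.15]
[cite: Hida1986] -/
theorem EdgeCap_of_facts :
    Literature.NumberTheory.EllipticCurves.hida_exists_congruent_ordinary_newform →
    Literature.NumberTheory.EllipticCurves.greenbergStevens_kitagawa_twoVariable_interpolation →
    Literature.NumberTheory.EllipticCurves.ModularForms.exists_isNewformOf →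
    (∀ (W : WeierstrassCurve ℚ) [W.IsElliptic] [W.IsGloballyMinimal] (_ : NeZero (W.conductorNorm ℤ)) (p : ℕ) [Fact
      p.Prime], 5 ≤ p → W.HasGoodReductionAtPrime p → ¬ (p : ℤ) ∣ W.frobeniusTrace p → ¬ (p : ℤ) ∣ (W.frobeniusTrace
      p) ^ 2 - 1 → W.HasSurjectiveModNGaloisRep p → (∀ (M : ℕ) (_ : NeZero M) (g : CuspForm
      (CongruenceSubgroup.Gamma0 M) 2) (ι : Literature.NumberTheory.EllipticCurves.ModularForms.coeffField g →+*
      PadicAlgCl p), M ∣ W.conductorNorm ℤ * p → Literature.NumberTheory.EllipticCurves.ModularForms.IsNewform0 g →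
      ‖ι ⟨(UpperHalfPlane.qExpansion 1 ⇑g).coeff p,
      Literature.NumberTheory.EllipticCurves.ModularForms.coeff_mem_coeffField g p⟩‖ = 1 → (∀ ℓ : ℕ, ℓ.Prime → ¬ ℓ ∣
      W.conductorNorm ℤ * p → ‖ι ⟨(UpperHalfPlane.qExpansion 1 ⇑g).coeff ℓ,
      Literature.NumberTheory.EllipticCurves.ModularForms.coeff_mem_coeffField g ℓ⟩ - ((W.frobeniusTrace ℓ : ℤ) :
      PadicAlgCl p)‖ < 1) → M = W.conductorNorm ℤ ∧ ∀ n : ℕ, (UpperHalfPlane.qExpansion 1 ⇑g).coeff n =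
      ((W.LFunction n : ℤ) : ℂ)) → ∀ (a b : ℕ), 0 < b → 2 * a < b → a.Coprime b → ∀ F : MvPowerSeries (Fin 2) ℚ_[p],
      Literature.NumberTheory.EllipticCurves.IsPadicInt F → (∃ i : ℕ, MvPowerSeries.coeff (Finsupp.single 1 i) F ≠
      0) → (∀ (k : ℤ) (g : CuspForm (CongruenceSubgroup.Gamma0 (W.conductorNorm ℤ)) k) (ι :
      Literature.NumberTheory.EllipticCurves.ModularForms.coeffField g →+* PadicAlgCl p) (s : ℕ), (2 * b * (p - 1) :
      ℤ) ∣ (k - 2) → (b : ℤ) * ((s : ℤ) - 1) = a * (k - 2) →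
      Literature.NumberTheory.EllipticCurves.ModularForms.IsNewform0 g → ‖ι ⟨(UpperHalfPlane.qExpansion 1 ⇑g).coeff
      p, Literature.NumberTheory.EllipticCurves.ModularForms.coeff_mem_coeffField g p⟩‖ = 1 → (∀ ℓ : ℕ, ℓ.Prime → ¬
      ℓ ∣ W.conductorNorm ℤ * p → ‖ι ⟨(UpperHalfPlane.qExpansion 1 ⇑g).coeff ℓ,
      Literature.NumberTheory.EllipticCurves.ModularForms.coeff_mem_coeffField g ℓ⟩ - ((W.frobeniusTrace ℓ : ℤ) :
      PadicAlgCl p)‖ < 1) → ∀ j : ℕ, Odd j → 3 ≤ j → (p - 1) ∣ (j - 1) → 2 * (j : ℤ) + 2 ≤ k →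
      Literature.NumberTheory.EllipticCurves.padicEval₂ F ((1 + (p : ℚ_[p])) ^ (k - 2) - 1) ((1 + (p : ℚ_[p])) ^ (j
      - 1) - 1) ≠ 0 ∧ ∀ hR : (∫ t in Set.Ioi (0 : ℝ), ((t : ℂ) ^ (s - 1)) * g (UpperHalfPlane.ofComplex ((t : ℂ) *
      Complex.I))) / (∫ t in Set.Ioi (0 : ℝ), ((t : ℂ) ^ (j - 1)) * g (UpperHalfPlane.ofComplex ((t : ℂ) *
      Complex.I))) ∈ Literature.NumberTheory.EllipticCurves.ModularForms.coeffField g, ‖ι ⟨_, hR⟩‖ *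
      ‖Literature.NumberTheory.EllipticCurves.padicEval₂ F ((1 + (p : ℚ_[p])) ^ (k - 2) - 1) ((1 + (p : ℚ_[p])) ^ (j
      - 1) - 1)‖ = ‖Literature.NumberTheory.EllipticCurves.padicEval₂ F ((1 + (p : ℚ_[p])) ^ (k - 2) - 1) ((1 + (p :
      ℚ_[p])) ^ (s - 1) - 1)‖) → (∀ t : ℕ, 0 < t → ∃ (g : CuspForm (CongruenceSubgroup.Gamma0 (W.conductorNorm ℤ))
      ((2 + 2 * b * (p - 1) * t : ℕ) : ℤ)) (ι : Literature.NumberTheory.EllipticCurves.ModularForms.coeffField g →+*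
      PadicAlgCl p), Literature.NumberTheory.EllipticCurves.ModularForms.IsNewform0 g ∧ ‖ι
      ⟨(UpperHalfPlane.qExpansion 1 ⇑g).coeff p,
      Literature.NumberTheory.EllipticCurves.ModularForms.coeff_mem_coeffField g p⟩‖ = 1 ∧ (∀ ℓ : ℕ, ℓ.Prime → ¬ ℓ ∣
      W.conductorNorm ℤ * p → ‖ι ⟨(UpperHalfPlane.qExpansion 1 ⇑g).coeff ℓ,
      Literature.NumberTheory.EllipticCurves.ModularForms.coeff_mem_coeffField g ℓ⟩ - ((W.frobeniusTrace ℓ : ℤ) :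
      PadicAlgCl p)‖ < 1)) → ∃ C₀ : ℕ, ∀ t : ℕ, 0 < t → ‖Literature.NumberTheory.EllipticCurves.padicEval₂ F ((1 +
      (p : ℚ_[p])) ^ (2 * b * (p - 1) * t) - 1) ((1 + (p : ℚ_[p])) ^ (2 * a * (p - 1) * t) - 1)‖ ≤ (p : ℝ) ^ C₀ *
      ‖(t : ℚ_[p])‖ ^ W.selmerCorank p) →
    Summit.BirchSwinnertonDyer.BirchSwinnertonDyer.Theses.TangentCone.EdgeCap :=
  fun hHida hGS hmod hA2 =>
    EdgeCap_of_stubs (stub_membersExist_of_hida hHida) (interpolant_of_facts hGS hmod) hA2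

end Summit.BirchSwinnertonDyer.BirchSwinnertonDyer.Theorems

end
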